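import Summits.CriticalPhenomena.CardyFormulaZ2.Theorems.CardyComplexConeParafermionToSLESixFamiliesFlipDefs
import Summits.CriticalPhenomena.CardyFormulaZ2.Theorems.CardyComplexConeParafermionToSLESixFamiliesIicDiagArmLower
import HarnessLib

/-!
# Strategist's decomposition of crux `ParafermionToSLESixFamilies` (stmt-CriticalPhenomena-11389) — the glue, certified

Route `CardyComplexCone` (sub-problem `CriticalPhenomena/CardyFormulaZ2`), crux
`Summit.CriticalPhenomena.CardyFormulaZ2.Theses.CardyComplexCone.ParafermionToSLESixFamilies` (literally `A → B → C`,
`Disproof.crux_iff`; A, B idle — `Disproof.lean` §1/§5). Crux-strategist seat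
`planner-cstrat-stmt-CriticalPhenomena-11389-s1-0`, census `Cruxes/ParafermionToSLESixFamilies/STRATEGY-CENSUS.md`.

The crux is split (`ledger route edit … --split ParafermionToSLESixFamilies`) into four children, stated here EXACTLY as they are
rendered in the route file (statements over the route file's import closure only; `winding` pinned to `Polyline.winding`):

* `DiagBoundaryArmLower` — the DIAGONAL half-plane one-arm lower bound up to constants (`π◇(n) ≥ c·n^{-1/3}` eventually);
  `diagBoundaryArmLower_iff`: it is `FlipInvolutionReturnLaw.DiagHalfPlaneOneArmLower` (`Iff.rfl`), hence CONDITIONALLY PROVED from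
  the named fact `IkhlefPonsaingFirstPassage` by `IicTraceFluxPairing.diagHalfPlaneOneArmLower_eventually_of_ikhlefPonsaing` (p119507):
  `diagBoundaryArmLower_of_ikhlefPonsaing`. Open unconditionally (rigorous: `≥ c·n^{-1/2}`). The input N of `Disproof.lean` §4 in the
  form both surviving lines consume (flip `stub_diagArmLower`, diamond S3 (c)).
* `UniformInnerEnvelope` — ONE constant bounding the spin-`1/3` corner observable by `(lattice depth)^{-1/3}` over all Jordan Dobrushin
  domains and admissible data; `uniformInnerEnvelope_iff`: it is crux 11387's milestone
  `EdgePrecompact.QkzStripBoundaryArm.UniformInnerEnvelope` (definitionally, `cornerObs` inlined). Feeds flip's MESO and diamond S3 (a).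
* `CornerClassControl` — the route's thesis `X = EdgeCoherence ∧ EdgePrecompact` (definitionally `Target`, `cornerClassControl_iff_target`);
  it routes the corner-class information, which `CoherentMorera` squeezes through the lossy vertex-observable interface (A, B), directly
  into #5 (route KILL CRITERIA (7)); it closes by `cornerClassControl_of_cruxes` once #2 and #3 close. Feeds diamond S3 (b′).
* `SLESixTransport` — `DiagBoundaryArmLower → UniformInnerEnvelope → CornerClassControl → ParafermionToSLESixFamilies`: the
  technique-owned XL remainder (the diamond identification engine, pin uniformity U of the monotone touch laws, Kemppainen–Smirnov
  tightness for the raw medial polyline, polygons → all domains).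

`ParafermionToSLESixFamilies_of_subs` is the glue (modus ponens). NOTHING here is asserted: every `def … : Prop` is a statement to be
proved as a route item; the theorems are definitional identities, the conditional corollary and the glue.
-/

noncomputable section

namespace Summit.CriticalPhenomena.CardyFormulaZ2.Cruxes.ParafermionToSLESixFamilies.StrategistSplit

open scoped Topology BigOperators
open Filter Set MeasureTheory
open Summit.CriticalPhenomena.CardyFormulaZ2.Theses.CardyComplexCone
  (EdgeCoherence EdgePrecompact Target ParafermionToSLESixFamilies)

/-! ## §1 The four children, verbatim as rendered in the route file -/

/-- **Child 1 — `DiagBoundaryArmLower`**: there is `c > 0` such that for all large `n`, with `P_{1/2}`-probability at least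
`c·n^{-1/3}` the origin is joined by an open path inside the diagonal half-box `{v₀+v₁ ≤ 1, −n ≤ v₀+v₁, |v₀−v₁| ≤ n}` to one of
its three far sides. Verbatim `FlipInvolutionReturnLaw.DiagHalfPlaneOneArmLower` (fully qualified names).
(source: IkhlefPonsaing2012, Prop. 4.7) (source: SmirnovWerner2001, β₁⁺ = 1/3 on 𝕋) -/
def DiagBoundaryArmLower : Prop :=
  ∃ c : ℝ, 0 < c ∧ ∀ᶠ n : ℕ in Filter.atTop, c * (n : ℝ) ^ (-((1:ℝ) / 3)) ≤ (Literature.Probability.Percolation.bondPercolation (Literature.Probability.LatticeModels.zdGraph 2) Literature.Probability.Percolation.half).real {ω | ∃ y : Literature.Probability.LatticeModels.Site 2, (y 0 + y 1 = -(n : ℤ) ∨ y 0 - y 1 = (n : ℤ) ∨ y 0 - y 1 = -(n : ℤ)) ∧ ω ∈ Literature.Probability.Percolation.openConnIn {v : Literature.Probability.LatticeModels.Site 2 | v 0 + v 1 ≤ 1 ∧ -(n : ℤ) ≤ v 0 + v 1 ∧ -(n : ℤ) ≤ v 0 - v 1 ∧ v 0 - v 1 ≤ n} 0 y}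

/-- **Child 2 — `UniformInnerEnvelope`**: one constant `C` such that for every Jordan Dobrushin domain `D`, every ℤ²-admissible
datum `E` with carrier `D` (arbitrary admissible arcs, any mesh) and every corner `(v, f)` of lattice depth `≥ R ≥ 1`
(`R·δ ≤ dist(δv, Dᶜ)`), the spin-`1/3` corner observable is at most `C·R^{-1/3}`. Verbatim
`EdgePrecompact.QkzStripBoundaryArm.UniformInnerEnvelope` with `cornerObs` inlined.
(source: DuminilCopinSmirnov2012Lattice, Conjecture 8.7 with Koebe distortion) -/
def UniformInnerEnvelope : Prop :=
  ∃ C : ℝ, ∀ (D : Literature.Probability.RandomPlanarGeometry.DobrushinDomain) (E : Literature.Probability.LatticeModels.DiscreteDobrushin), E.Ω = D.carrier → E.IsZdAdmissible → ∀ v f : Literature.Probability.LatticeModels.Site 2, Literature.Probability.LatticeModels.IsCorner v f → ∀ R : ℕ, 1 ≤ R → (R : ℝ) * E.δ ≤ Metric.infDist (Literature.Probability.LatticeModels.meshPoint E.δ v) D.carrierᶜ → ‖(∫ ω, (let γ := Literature.Probability.LatticeModels.medialExploration E ω; ∑ k ∈ (Finset.range γ.length).filter (fun k => γ[k]? = some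 (Literature.Probability.LatticeModels.cornerSource v f) ∧ γ[k + 1]? = some (Literature.Probability.LatticeModels.cornerTarget v f)), Complex.exp (-(Complex.I / 3) * ((Literature.Probability.LatticeModels.Polyline.winding ((γ.map (Literature.Probability.LatticeModels.medialPoint E.δ)).take (k + 2)) : ℝ) : ℂ))) ∂(Literature.Probability.Percolation.bondPercolation (Literature.Probability.LatticeModels.zdGraph 2) Literature.Probability.Percolation.half))‖ ≤ C * (R : ℝ) ^ (-(1:ℝ) / 3)

/-- **Child 3 — `CornerClassControl`**: the route's thesis `X = EdgeCoherence ∧ EdgePrecompact` by name (definitionally the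
route's `Target`). -/
def CornerClassControl : Prop :=
  EdgeCoherence ∧ EdgePrecompact

/-- **Child 4 — `SLESixTransport`**: the two sharp boundary inputs and the corner-class control imply the crux. -/
def SLESixTransport : Prop :=
  DiagBoundaryArmLower → UniformInnerEnvelope → CornerClassControl → ParafermionToSLESixFamilies

/-! ## §2 The glue and the identities -/

/-- **The glue of the split** (modus ponens): the four children prove the crux `CardyComplexCone.ParafermionToSLESixFamilies`
BY NAME. -/
theorem ParafermionToSLESixFamilies_of_subs :
    DiagBoundaryArmLower → UniformInnerEnvelope → CornerClassControl → SLESixTransport → ParafermionToSLESixFamilies :=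
  fun h₁ h₂ h₃ h₄ => h₄ h₁ h₂ h₃

/-- Child 1 is verbatim the flip line's `DiagHalfPlaneOneArmLower`. -/
theorem diagBoundaryArmLower_iff : DiagBoundaryArmLower ↔ FlipInvolutionReturnLaw.DiagHalfPlaneOneArmLower :=
  Iff.rfl

/-- Child 2 is verbatim crux 11387's milestone `UniformInnerEnvelope` (with `cornerObs` unfolded). -/
theorem uniformInnerEnvelope_iff :
    UniformInnerEnvelope ↔ Summit.CriticalPhenomena.CardyFormulaZ2.Cruxes.EdgePrecompact.QkzStripBoundaryArm.UniformInnerEnvelope := by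
  unfold UniformInnerEnvelope Summit.CriticalPhenomena.CardyFormulaZ2.Cruxes.EdgePrecompact.QkzStripBoundaryArm.UniformInnerEnvelope
    Summit.CriticalPhenomena.CardyFormulaZ2.Cruxes.EdgePrecompact.QkzStripBoundaryArm.cornerObs
  exact Iff.rfl

/-- Child 3 is definitionally the route's `Target`. -/
theorem cornerClassControl_iff_target : CornerClassControl ↔ Target :=
  Iff.rfl

/-- Child 3 closes as soon as the two leading cruxes do. -/
theorem cornerClassControl_of_cruxes (hC : EdgeCoherence) (hP : EdgePrecompact) : CornerClassControl :=
  ⟨hC, hP⟩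

/-- Child 1 is CONDITIONALLY PROVED: the named fact `IkhlefPonsaingFirstPassage` (IP12 Prop. 4.7) implies it (p119507). -/
theorem diagBoundaryArmLower_of_ikhlefPonsaing
    (h : Literature.Probability.Percolation.IkhlefPonsaingFirstPassage) : DiagBoundaryArmLower :=
  IicTraceFluxPairing.diagHalfPlaneOneArmLower_eventually_of_ikhlefPonsaing h

/-- Hence, conditionally on IP12, the crux reduces to children 2–4. -/
theorem parafermionToSLESixFamilies_of_ikhlefPonsaing
    (h : Literature.Probability.Percolation.IkhlefPonsaingFirstPassage)
    (h₂ : UniformInnerEnvelope) (h₃ : CornerClassControl) (h₄ : SLESixTransport) : ParafermionToSLESixFamilies :=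
  ParafermionToSLESixFamilies_of_subs (diagBoundaryArmLower_of_ikhlefPonsaing h) h₂ h₃ h₄

end Summit.CriticalPhenomena.CardyFormulaZ2.Cruxes.ParafermionToSLESixFamilies.StrategistSplit

end
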